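import Literature.MathematicalPhysics.QuantumLattice.HubbardTTPrimeCanonicalStatesGrandCanonicalEquilibrium
import Literature.MathematicalPhysics.QuantumLattice.HubbardTTPrimeThermalPhaseCoexistenceCanonical
import Literature.MathematicalPhysics.QuantumLattice.TIGroundEnergyDensityConservedDensities
import Literature.MathematicalPhysics.QuantumLattice.FermionEntropyChainRule
import HarnessLib

/-!
# The translation-invariant VARIATIONAL PRESSURE of a finite-range lattice-fermion interaction at `T > 0`:
# `P(β, Ψ) = sup_ω [s̄(ω) − β e_Ψ(ω)]` — convexity, Lipschitz transport, tangent planes for equilibrium states, and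
# the identification with the `t–t'` Hubbard pressures

Topic `Literature/MathematicalPhysics/QuantumLattice` (family `hubbard`); the `T > 0` twin of `TIGroundEnergyDensityResponse` /
`TIGroundEnergyDensityCouplingFamilies` (`T = 0`: `e₀(Ψ) = inf_ω e_Ψ(ω)` over translation-invariant states, concave and Lipschitz in
the couplings, tangent planes at minimisers). At `T > 0` the object is Araki–Moriya's variational pressure
`P(βΨ) = sup {s(ω) − β e_Ψ(ω) : ω translation invariant}` (Rev. Math. Phys. 15 (2003) 93, §11 eq. (11.21)/(12.1)), here with
`s̄(ω) := limsup_ℓ S(ω_{[0,ℓ)^d})/ℓ^d` (so that no existence theorem for the mean entropy is needed):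

* §1 `InfVolFermionState.entropyDensitySup ω` (`s̄`): `0 ≤ s̄ ≤ 2 log 2`; `= lim` when the limit exists; `≤ a` from «eventually
  `≤ a + ε`» bounds; `≥ a` from «eventually `≥ a`».
* §2 `FermionInteraction.varPressure β Ψ R` (`P`): the TRIAL PRINCIPLE `s̄(ω) − βe_Ψ(ω) ≤ P` for every translation-invariant
  `ω` (`sub_mul_le_varPressure`) and its converse reading (`varPressure_le`: a number above `s̄ − βe_Ψ` of every TI state caps `P`);
  `|P| < ∞`; **CONVEXITY** in `β` (`convexOn_varPressure_beta`) and along every linear family of couplings `Ψ(θ) = Ψ₀ + Σ θ_a Ψ_a`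
  (`convexOn_varPressure_linearFamily`) — suprema of affine functions; **LIPSCHITZ / comparison** (`abs_varPressure_sub_le`: a uniform bound
  `|e_Ψ(ω) − e_Ψ'(ω)| ≤ C` over TI states gives `|P(Ψ) − P(Ψ')| ≤ |β|C`; `varPressure_anti`), the interaction-norm form
  (`abs_varPressure_linearFamily_sub_le`: `|P(θ) − P(θ')| ≤ |β| Σ_a |θ_a − θ'_a| ‖E_{Ψ_a}‖`).
* §3 **EQUILIBRIUM STATES** `IsVarEquilibrium β Ψ R ω` (TI maximisers) and the MASTER INEQUALITY
  `P(β₁,Ψ₁) ≥ P(β,Ψ) + βe_Ψ(ω) − β₁e_{Ψ₁}(ω)` (`IsVarEquilibrium.varPressure_add_le`); consequences for ANY model: energy antitone in `β`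
  across equilibria (`…mul_sub_meanEnergy_sub_nonpos`), the cross-variational inequality along linear families
  `β Σ_a (θ'_a − θ_a)(e_a(ω') − e_a(ω)) ≤ 0` (`…sum_mul_sub_mul_sub_nonpos`, conjugate densities are antitone in their own coupling),
  and the Griffiths/Bogoliubov bracket of a conjugate density from pressures at neighbouring couplings
  (`…varPressure_sub_mul_le_update`: `P(θ + δ·1_a) ≥ P(θ) − βδ·e_a(ω)`).
* §4 **IDENTIFICATION FOR THE 2D `t–t'` HUBBARD MODEL** (`β ≥ 0`, `U ≥ 0`): with the grand-canonical interaction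
  `gcInteractionTT' t t' U μ h = Φ(t,t',U) − μ·n − h·m` (a `linearFamily`; `meanEnergy_gcInteractionTT' = u(ω)`):
  **`varPressure_gcInteractionTT'_eq : P(β, Φ_GC) = gcPressureTT'Zeeman β t t' U μ h`** (upper half for every TI state from
  `…ThermalStatesEntropyDensity`, attained by thermal grand-canonical states), thermal GC torus-limit states and CANONICAL thermal torus-limit
  states (at a supporting `μ₀`) are `IsVarEquilibrium` (`…of_gcGibbs`, `…of_sectorGibbs`); and the canonical pressure as a constrained supremum
  bound (`entropyDensitySup_sub_mul_le_pressureTT'`: `s̄(ω) − βe_Φ(ω) ≤ p(β;ρ(ω))` for every TI `ω` with `0 < ρ(ω) < 2`, attained by canonical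
  thermal states `…eq_pressureTT'_add_of_sectorGibbs`).

Everything is PROVED; definitions with bodies: `entropyDensitySup`, `varPressure`, `IsVarEquilibrium`, `gcInteractionTT'`; no named fact, no
number. HONEST SCOPE: `P(β,Ψ)` is the VARIATIONAL pressure; its equality with a thermodynamic limit of finite-volume partition functions is
proved here only for the `t–t'` Hubbard family (§4); for other families (further hoppings, layers, several bands) the convexity/Lipschitz/tangent
calculus of §2–§3 applies at once, and finite-volume certificates enter through §4-type identifications when they exist.

## Mathlib / tree search

REUSED: `InfVolFermionState.meanEnergy`, `abs_meanEnergy_le_norm`, `vacuumState_isTranslationInvariant`, `tiGroundEnergyDensity` pattern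
(`TIGroundEnergyDensityResponse`); `FermionInteraction.linearFamily`, `meanEnergy_linearFamily(_eq_add_sum_sub_mul)` (`…CouplingFamilies`);
`numberInteraction`, `spinImbalanceInteraction`, `meanEnergy_numberInteraction`, `meanEnergy_spinImbalanceInteraction` (`…ConservedDensities`,
`…Response`); `vonNeumannEntropy_nonneg`, `vonNeumannEntropy_le_log_card` (`FermionEntropyChainRule`), `card_halfOpenBox`;
`IsTranslationInvariant.eventually_vonNeumannEntropy_rdm_div_sq_le`, `IsTorusLimitOfMixture.tendsto_vonNeumannEntropy_rdm_div_sq_of_gcGibbs`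
(`…ThermalStatesEntropyDensity`), `exists_isTorusLimitOfMixture_gcGibbs_translationInvariant`, `…tendsto_vonNeumannEntropy_rdm_div_sq_gc_of_sectorGibbs`
(`…CanonicalStatesGrandCanonicalEquilibrium`), `IsTranslationInvariant.vonNeumannEntropy_rdm_halfOpenBox_div_sq_le_pressureTT'`
(`…ThermalPhaseCoexistenceCanonical`); Mathlib `Filter.limsup`, `Tendsto.limsup_eq`, `limsup_le_of_le`, `le_limsup_of_frequently_le`.
`lean search 'varPressure|variational pressure|entropyDensitySup'` (2026-08-27): nothing.

## References

* H. Araki, H. Moriya, Rev. Math. Phys. 15 (2003) 93–198, §10 (mean entropy), §11 eq. (11.21) and Thm. 11.4/12.? (`P(Φ) = sup[s − e_Φ]`,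
  variational principle), §12.2 (solutions ↔ tangents). [cite: ArakiMoriya2003, Theorem 3.8 and §10]
* R. B. Israel, *Convexity in the Theory of Lattice Gases* (1979), Thm. I.3.4, Thm. I.2.4, §II.3. [cite: Israel1979, Thm. I.2.4]
* O. Bratteli, D. W. Robinson, *Operator Algebras and Quantum Statistical Mechanics 2* (1997), Thm. 6.2.40 (variational principle
  for quantum lattice systems). [cite: BratteliRobinsonII1997, §5.2.2]
-/

noncomputable section

open scoped ComplexOrder BigOperators
open Finset Literature.InformationTheory.Entropy

namespace Literature.MathematicalPhysics.QuantumLattice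

open Matrix HubbardWave0 Literature.Probability.LatticeModels ThermodynamicLimit
open _root_.Filter
open scoped _root_.Topology

/-! ### §1 The upper entropy density of a state -/

namespace InfVolFermionState

variable {d : ℕ} (ω : InfVolFermionState d)

/-- The box-entropy-per-volume sequence `ℓ ↦ S(ω_{[0,ℓ)^d})/ℓ^d`. [cite: ArakiMoriya2003, Theorem 3.8 and §10] -/
def boxEntropyDensity (ℓ : ℕ) : ℝ := vonNeumannEntropy (ω.rdm (halfOpenBox d ℓ)) / ((ℓ : ℝ) ^ d)

/-- Unfolding. [cite: ArakiMoriya2003, Theorem 3.8 and §10] -/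
theorem boxEntropyDensity_apply (ℓ : ℕ) :
    ω.boxEntropyDensity ℓ = vonNeumannEntropy (ω.rdm (halfOpenBox d ℓ)) / ((ℓ : ℝ) ^ d) := rfl

/-- `0 ≤ S(ω_B)/ℓ^d`. [cite: ArakiMoriya2003, Theorem 3.8 and §10] -/
theorem boxEntropyDensity_nonneg (ℓ : ℕ) : 0 ≤ ω.boxEntropyDensity ℓ :=
  div_nonneg (vonNeumannEntropy_nonneg (ω.rdm_posSemidef _) (ω.trace_rdm _)) (by positivity)

/-- The Fock space of a box of `m` sites has dimension `4^m`: `log dim = 2 m log 2`. [folklore] -/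
private theorem log_card_fock_halfOpenBox (ℓ : ℕ) :
    Real.log (Fintype.card (Finset (Orb (PolySite (halfOpenBox d ℓ))))) = 2 * (ℓ : ℝ) ^ d * Real.log 2 := by
  have hc : #(lexSites (halfOpenBox d ℓ)) = ℓ ^ d := by
    rw [lexSites, Finset.card_map, card_halfOpenBox]
  rw [Fintype.card_finset, Fintype.card_lex, Fintype.card_prod, Fintype.card_fin, Fintype.card_coe, hc]
  push_cast
  rw [Real.log_pow]
  push_cast
  ring

/-- `S(ω_B)/ℓ^d ≤ 2 log 2` (four states per site). [cite: ArakiMoriya2003, Theorem 3.8 and §10] -/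
theorem boxEntropyDensity_le (ℓ : ℕ) : ω.boxEntropyDensity ℓ ≤ 2 * Real.log 2 := by
  rw [boxEntropyDensity_apply]
  have hS := vonNeumannEntropy_le_log_card (ω.rdm_posSemidef (halfOpenBox d ℓ)) (ω.trace_rdm _)
  rw [log_card_fock_halfOpenBox] at hS
  have hlog2 : 0 ≤ Real.log 2 := Real.log_nonneg (by norm_num)
  rcases eq_or_lt_of_le (show (0 : ℝ) ≤ (ℓ : ℝ) ^ d by positivity) with h0 | hpos
  · rw [← h0, div_zero]; positivity
  · rw [div_le_iff₀ hpos]; linarith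

/-- **The upper entropy density** `s̄(ω) = limsup_ℓ S(ω_{[0,ℓ)^d})/ℓ^d` (the mean entropy whenever the limit exists).
[cite: ArakiMoriya2003, Theorem 3.8 and §10] -/
def entropyDensitySup : ℝ := Filter.limsup ω.boxEntropyDensity atTop

/-- Boundedness above of the box-entropy sequence (for the `limsup` API). [folklore] -/
private theorem isBoundedUnder_boxEntropyDensity : IsBoundedUnder (· ≤ ·) atTop ω.boxEntropyDensity :=
  isBoundedUnder_of ⟨2 * Real.log 2, fun ℓ => ω.boxEntropyDensity_le ℓ⟩

/-- Coboundedness of the box-entropy sequence (for the `limsup` API). [folklore] -/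
private theorem isCoboundedUnder_boxEntropyDensity : IsCoboundedUnder (· ≤ ·) atTop ω.boxEntropyDensity :=
  isCoboundedUnder_le_of_le atTop fun ℓ => ω.boxEntropyDensity_nonneg ℓ

/-- **If the entropy density exists it is `s̄`**: `S(ω_B)/ℓ^d → s ⇒ s̄(ω) = s`. [cite: ArakiMoriya2003, Theorem 3.8 and §10] -/
theorem entropyDensitySup_eq_of_tendsto {s : ℝ}
    (h : Tendsto (fun ℓ : ℕ => vonNeumannEntropy (ω.rdm (halfOpenBox d ℓ)) / ((ℓ : ℝ) ^ d)) atTop (𝓝 s)) :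
    ω.entropyDensitySup = s :=
  Tendsto.limsup_eq h

/-- `s̄ ≤ a` from «for every `ε > 0`, eventually `S(ω_B)/ℓ^d ≤ a + ε`». [cite: ArakiMoriya2003, Theorem 3.8 and §10] -/
theorem entropyDensitySup_le_of_eventually {a : ℝ}
    (h : ∀ ε : ℝ, 0 < ε → ∀ᶠ ℓ : ℕ in atTop, vonNeumannEntropy (ω.rdm (halfOpenBox d ℓ)) / ((ℓ : ℝ) ^ d) ≤ a + ε) :
    ω.entropyDensitySup ≤ a := by
  refine le_of_forall_pos_le_add fun ε hε => ?_
  exact limsup_le_of_le ω.isCoboundedUnder_boxEntropyDensity (h ε hε)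

/-- `a ≤ s̄` from «eventually `a ≤ S(ω_B)/ℓ^d`». [cite: ArakiMoriya2003, Theorem 3.8 and §10] -/
theorem le_entropyDensitySup_of_eventually {a : ℝ}
    (h : ∀ᶠ ℓ : ℕ in atTop, a ≤ vonNeumannEntropy (ω.rdm (halfOpenBox d ℓ)) / ((ℓ : ℝ) ^ d)) :
    a ≤ ω.entropyDensitySup :=
  le_limsup_of_frequently_le h.frequently ω.isBoundedUnder_boxEntropyDensity

/-- `0 ≤ s̄(ω)`. [cite: ArakiMoriya2003, Theorem 3.8 and §10] -/
theorem entropyDensitySup_nonneg : 0 ≤ ω.entropyDensitySup :=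
  ω.le_entropyDensitySup_of_eventually (Eventually.of_forall fun ℓ => ω.boxEntropyDensity_nonneg ℓ)

/-- `s̄(ω) ≤ 2 log 2`. [cite: ArakiMoriya2003, Theorem 3.8 and §10] -/
theorem entropyDensitySup_le : ω.entropyDensitySup ≤ 2 * Real.log 2 :=
  ω.entropyDensitySup_le_of_eventually fun ε hε => Eventually.of_forall fun ℓ => by
    have h := ω.boxEntropyDensity_le ℓ
    rw [boxEntropyDensity_apply] at h
    linarith

end InfVolFermionState

/-! ### §2 The variational pressure -/

namespace FermionInteraction

variable {d : ℕ}

/-- **The translation-invariant variational pressure** `P(β, Ψ) = sup {s̄(ω) − β e_Ψ(ω) : ω translation invariant}` of a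
lattice-fermion interaction `Ψ` (mean energy at range parameter `R`) at inverse temperature `β`.
[cite: ArakiMoriya2003, Theorem 3.8 and §10] [cite: Israel1979, Thm. I.2.4] -/
def varPressure (β : ℝ) (Ψ : FermionInteraction d) (R : ℝ) : ℝ :=
  sSup ((fun ω : InfVolFermionState d => ω.entropyDensitySup - β * ω.meanEnergy Ψ R) ''
    {ω : InfVolFermionState d | ω.IsTranslationInvariant})

variable (β : ℝ) (Ψ : FermionInteraction d) (R : ℝ)

open scoped Matrix.Norms.L2Operator in
/-- The variational functional is bounded above by `2 log 2 + |β|‖E_Ψ‖` on translation-invariant states.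
[cite: BratteliRobinsonI1987, Prop. 2.3.11] -/
theorem bddAbove_varFunctional_image :
    BddAbove ((fun ω : InfVolFermionState d => ω.entropyDensitySup - β * ω.meanEnergy Ψ R) ''
      {ω : InfVolFermionState d | ω.IsTranslationInvariant}) := by
  refine ⟨2 * Real.log 2 + |β| * ‖Ψ.meanEnergyObs R‖, ?_⟩
  rintro _ ⟨ω, -, rfl⟩
  have h1 := ω.entropyDensitySup_le
  have h2 : -(β * ω.meanEnergy Ψ R) ≤ |β| * ‖Ψ.meanEnergyObs R‖ := by
    have h := ω.abs_meanEnergy_le_norm Ψ R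
    calc -(β * ω.meanEnergy Ψ R) ≤ |β * ω.meanEnergy Ψ R| := neg_le_abs _
      _ = |β| * |ω.meanEnergy Ψ R| := abs_mul _ _
      _ ≤ |β| * ‖Ψ.meanEnergyObs R‖ := mul_le_mul_of_nonneg_left h (abs_nonneg β)
  linarith

/-- The image set is non-empty (the Fock vacuum is translation invariant). [cite: BratteliKishimotoRobinson1978, §3 (mean energy functional)] -/
theorem varFunctional_image_nonempty :
    ((fun ω : InfVolFermionState d => ω.entropyDensitySup - β * ω.meanEnergy Ψ R) ''
      {ω : InfVolFermionState d | ω.IsTranslationInvariant}).Nonempty :=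
  ⟨_, Set.mem_image_of_mem _ (InfVolFermionState.vacuumState_isTranslationInvariant (d := d))⟩

/-- **THE TRIAL PRINCIPLE**: `s̄(ω) − β e_Ψ(ω) ≤ P(β, Ψ)` for every translation-invariant state — any TI trial state with a known
entropy density and energy is a pressure FLOOR. [cite: ArakiMoriya2003, Theorem 3.8 and §10] [cite: Israel1979, Thm. I.2.4] -/
theorem sub_mul_le_varPressure {ω : InfVolFermionState d} (hω : ω.IsTranslationInvariant) :
    ω.entropyDensitySup - β * ω.meanEnergy Ψ R ≤ Ψ.varPressure β R :=
  le_csSup (Ψ.bddAbove_varFunctional_image β R) (Set.mem_image_of_mem _ hω)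

/-- **`P` is the least such bound**: a number above `s̄(ω) − βe_Ψ(ω)` for every translation-invariant `ω` caps `P(β, Ψ)` — the form in
which a uniform variational CAP is read. [cite: ArakiMoriya2003, Theorem 3.8 and §10] -/
theorem varPressure_le {c : ℝ}
    (h : ∀ ω : InfVolFermionState d, ω.IsTranslationInvariant → ω.entropyDensitySup - β * ω.meanEnergy Ψ R ≤ c) :
    Ψ.varPressure β R ≤ c :=
  csSup_le (Ψ.varFunctional_image_nonempty β R) (by
    rintro _ ⟨ω, hω, rfl⟩
    exact h ω hω)

/-- If `c < P` some translation-invariant state has `s̄ − βe_Ψ > c`. [cite: ArakiMoriya2003, Theorem 3.8 and §10] -/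
theorem exists_lt_sub_mul_of_lt_varPressure {c : ℝ} (h : c < Ψ.varPressure β R) :
    ∃ ω : InfVolFermionState d, ω.IsTranslationInvariant ∧ c < ω.entropyDensitySup - β * ω.meanEnergy Ψ R := by
  obtain ⟨_, ⟨ω, hω, rfl⟩, hlt⟩ := (lt_csSup_iff (Ψ.bddAbove_varFunctional_image β R)
    (Ψ.varFunctional_image_nonempty β R)).1 h
  exact ⟨ω, hω, hlt⟩

open scoped Matrix.Norms.L2Operator in
/-- A-priori window: `−|β|‖E_Ψ‖ ≤ P(β,Ψ) ≤ 2 log 2 + |β|‖E_Ψ‖`. [cite: BratteliRobinsonI1987, Prop. 2.3.11] -/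
theorem varPressure_mem_Icc :
    Ψ.varPressure β R ∈ Set.Icc (-(|β| * ‖Ψ.meanEnergyObs R‖)) (2 * Real.log 2 + |β| * ‖Ψ.meanEnergyObs R‖) := by
  constructor
  · have hv := InfVolFermionState.vacuumState_isTranslationInvariant (d := d)
    have h := Ψ.sub_mul_le_varPressure β R hv
    have h0 := (vacuumState d).entropyDensitySup_nonneg
    have h2 : β * (vacuumState d).meanEnergy Ψ R ≤ |β| * ‖Ψ.meanEnergyObs R‖ := by
      have ha := (vacuumState d).abs_meanEnergy_le_norm Ψ R
      calc β * (vacuumState d).meanEnergy Ψ R ≤ |β * (vacuumState d).meanEnergy Ψ R| :=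
            le_abs_self _
        _ = |β| * |(vacuumState d).meanEnergy Ψ R| := abs_mul _ _
        _ ≤ |β| * ‖Ψ.meanEnergyObs R‖ := mul_le_mul_of_nonneg_left ha (abs_nonneg β)
    linarith
  · obtain ⟨b, hb⟩ := Ψ.bddAbove_varFunctional_image β R
    refine Ψ.varPressure_le β R fun ω hω => ?_
    have h1 := ω.entropyDensitySup_le
    have h2 : -(β * ω.meanEnergy Ψ R) ≤ |β| * ‖Ψ.meanEnergyObs R‖ := by
      have h := ω.abs_meanEnergy_le_norm Ψ R
      calc -(β * ω.meanEnergy Ψ R) ≤ |β * ω.meanEnergy Ψ R| := neg_le_abs _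
        _ = |β| * |ω.meanEnergy Ψ R| := abs_mul _ _
        _ ≤ |β| * ‖Ψ.meanEnergyObs R‖ := mul_le_mul_of_nonneg_left h (abs_nonneg β)
    linarith

/-- **`P(·, Ψ)` is CONVEX in `β`** (a supremum of affine functions of `β`). [cite: Israel1979, Thm. I.2.4] -/
theorem convexOn_varPressure_beta : ConvexOn ℝ Set.univ fun β : ℝ => Ψ.varPressure β R := by
  refine ⟨convex_univ, fun x _ y _ a b ha hb hab => ?_⟩
  simp only [smul_eq_mul]
  refine Ψ.varPressure_le (a * x + b * y) R fun ω hω => ?_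
  have hx := Ψ.sub_mul_le_varPressure x R hω
  have hy := Ψ.sub_mul_le_varPressure y R hω
  have e : ω.entropyDensitySup - (a * x + b * y) * ω.meanEnergy Ψ R =
      a * (ω.entropyDensitySup - x * ω.meanEnergy Ψ R) + b * (ω.entropyDensitySup - y * ω.meanEnergy Ψ R) := by
    linear_combination (ω.entropyDensitySup) * hab.symm
  rw [e]
  exact add_le_add (mul_le_mul_of_nonneg_left hx ha) (mul_le_mul_of_nonneg_left hy hb)

/-- **COMPARISON / LIPSCHITZ**: if `|e_Ψ(ω) − e_Ψ'(ω)| ≤ C` for every translation-invariant `ω` then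
`|P(β,Ψ) − P(β,Ψ')| ≤ |β|·C` — couplings that change every TI state's energy by at most `C` move the pressure by at most `|β|C`
(interlayer couplings, further-neighbour hoppings, …). [cite: Israel1979, Thm. I.3.4] -/
theorem abs_varPressure_sub_le (Ψ' : FermionInteraction d) (R' : ℝ) {C : ℝ}
    (h : ∀ ω : InfVolFermionState d, ω.IsTranslationInvariant → |ω.meanEnergy Ψ R - ω.meanEnergy Ψ' R'| ≤ C) :
    |Ψ.varPressure β R - Ψ'.varPressure β R'| ≤ |β| * C := by
  rw [abs_le]
  constructor
  · -- `P(Ψ') ≤ P(Ψ) + |β|C`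
    have : Ψ'.varPressure β R' ≤ Ψ.varPressure β R + |β| * C := by
      refine Ψ'.varPressure_le β R' fun ω hω => ?_
      have h1 := Ψ.sub_mul_le_varPressure β R hω
      have h2 : β * ω.meanEnergy Ψ R - β * ω.meanEnergy Ψ' R' ≤ |β| * C := by
        rw [← mul_sub]
        exact (le_abs_self _).trans (by rw [abs_mul]; exact mul_le_mul_of_nonneg_left (h ω hω) (abs_nonneg β))
      linarith
    linarith
  · have : Ψ.varPressure β R ≤ Ψ'.varPressure β R' + |β| * C := by
      refine Ψ.varPressure_le β R fun ω hω => ?_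
      have h1 := Ψ'.sub_mul_le_varPressure β R' hω
      have h2 : β * ω.meanEnergy Ψ' R' - β * ω.meanEnergy Ψ R ≤ |β| * C := by
        rw [← mul_sub]
        refine (le_abs_self _).trans ?_
        rw [abs_mul, abs_sub_comm]
        exact mul_le_mul_of_nonneg_left (h ω hω) (abs_nonneg β)
      linarith
    linarith

/-- **Monotonicity**: if `e_Ψ(ω) ≤ e_Ψ'(ω)` for every translation-invariant `ω` and `β ≥ 0` then `P(β,Ψ') ≤ P(β,Ψ)` (raising every
state's energy lowers the pressure; e.g. `P` is antitone in a repulsive coupling). [cite: Israel1979, Thm. I.3.4] -/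
theorem varPressure_anti (Ψ' : FermionInteraction d) (R' : ℝ) (hβ : 0 ≤ β)
    (h : ∀ ω : InfVolFermionState d, ω.IsTranslationInvariant → ω.meanEnergy Ψ R ≤ ω.meanEnergy Ψ' R') :
    Ψ'.varPressure β R' ≤ Ψ.varPressure β R := by
  refine Ψ'.varPressure_le β R' fun ω hω => ?_
  have h1 := Ψ.sub_mul_le_varPressure β R hω
  nlinarith [h ω hω]

end FermionInteraction

/-! ### §2b Linear families of couplings -/

section LinearFamily

variable {d : ℕ} {ι : Type*} [Fintype ι] (Ψ₀ : FermionInteraction d) (Ψ : ι → FermionInteraction d) (β R : ℝ)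

/-- **`θ ↦ P(β, Ψ₀ + Σ θ_a Ψ_a)` is CONVEX on `ℝ^ι`** (supremum of affine functions of the couplings).
[cite: Israel1979, Thm. I.3.4] -/
theorem convexOn_varPressure_linearFamily :
    ConvexOn ℝ Set.univ fun θ : ι → ℝ => (FermionInteraction.linearFamily Ψ₀ Ψ θ).varPressure β R := by
  refine ⟨convex_univ, fun x _ y _ a b ha hb hab => ?_⟩
  refine (FermionInteraction.linearFamily Ψ₀ Ψ (a • x + b • y)).varPressure_le β R fun ω hω => ?_
  have hx := (FermionInteraction.linearFamily Ψ₀ Ψ x).sub_mul_le_varPressure β R hω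
  have hy := (FermionInteraction.linearFamily Ψ₀ Ψ y).sub_mul_le_varPressure β R hω
  rw [ω.meanEnergy_linearFamily] at hx hy ⊢
  have hsum : ∑ a_1, (a • x + b • y) a_1 * ω.meanEnergy (Ψ a_1) R =
      a * ∑ a_1, x a_1 * ω.meanEnergy (Ψ a_1) R + b * ∑ a_1, y a_1 * ω.meanEnergy (Ψ a_1) R := by
    rw [Finset.mul_sum, Finset.mul_sum, ← Finset.sum_add_distrib]
    refine Finset.sum_congr rfl fun i _ => ?_
    simp only [Pi.add_apply, Pi.smul_apply, smul_eq_mul]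
    ring
  rw [hsum]
  have e : ω.entropyDensitySup - β * (ω.meanEnergy Ψ₀ R + (a * ∑ a_1, x a_1 * ω.meanEnergy (Ψ a_1) R +
      b * ∑ a_1, y a_1 * ω.meanEnergy (Ψ a_1) R)) =
      a * (ω.entropyDensitySup - β * (ω.meanEnergy Ψ₀ R + ∑ a_1, x a_1 * ω.meanEnergy (Ψ a_1) R)) +
        b * (ω.entropyDensitySup - β * (ω.meanEnergy Ψ₀ R + ∑ a_1, y a_1 * ω.meanEnergy (Ψ a_1) R)) := by
    linear_combination (ω.entropyDensitySup - β * ω.meanEnergy Ψ₀ R) * hab.symm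
  rw [e]
  simp only [smul_eq_mul]
  exact add_le_add (mul_le_mul_of_nonneg_left hx ha) (mul_le_mul_of_nonneg_left hy hb)

open scoped Matrix.Norms.L2Operator in
/-- **Joint Lipschitz bound in the couplings**: `|P(β,Ψ(θ)) − P(β,Ψ(θ'))| ≤ |β| Σ_a |θ_a − θ'_a| ‖E_{Ψ_a}‖`.
[cite: Israel1979, Thm. I.3.4] -/
theorem abs_varPressure_linearFamily_sub_le (θ θ' : ι → ℝ) :
    |(FermionInteraction.linearFamily Ψ₀ Ψ θ).varPressure β R - (FermionInteraction.linearFamily Ψ₀ Ψ θ').varPressure β R| ≤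
      |β| * ∑ a, |θ a - θ' a| * ‖(Ψ a).meanEnergyObs R‖ := by
  refine (FermionInteraction.linearFamily Ψ₀ Ψ θ).abs_varPressure_sub_le β R _ R fun ω _ => ?_
  rw [ω.meanEnergy_linearFamily_eq_add_sum_sub_mul Ψ₀ Ψ θ θ' R, add_sub_cancel_left]
  refine (Finset.abs_sum_le_sum_abs _ _).trans (Finset.sum_le_sum fun a _ => ?_)
  rw [abs_mul]
  exact mul_le_mul_of_nonneg_left (ω.abs_meanEnergy_le_norm (Ψ a) R) (abs_nonneg _)

end LinearFamily

/-! ### §3 Variational equilibrium states and their tangent planes -/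

namespace InfVolFermionState

variable {d : ℕ}

/-- **A variational equilibrium state** of `Ψ` at inverse temperature `β`: a translation-invariant maximiser of `s̄ − βe_Ψ`
(Araki–Moriya's «solution of the variational principle»). [cite: ArakiMoriya2003, Theorem 12.11] -/
def IsVarEquilibrium (β : ℝ) (Ψ : FermionInteraction d) (R : ℝ) (ω : InfVolFermionState d) : Prop :=
  ω.IsTranslationInvariant ∧ ω.entropyDensitySup - β * ω.meanEnergy Ψ R = Ψ.varPressure β R

variable {β : ℝ} {Ψ : FermionInteraction d} {R : ℝ} {ω ω' : InfVolFermionState d}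

/-- **THE MASTER INEQUALITY (joint tangent plane).** For an equilibrium state `ω` of `(β, Ψ)` and every `(β₁, Ψ₁)`:
`P(β₁,Ψ₁) ≥ P(β,Ψ) + β e_Ψ(ω) − β₁ e_{Ψ₁}(ω)` (the equilibrium state of one point is a trial state at every other point).
[cite: Israel1979, Thm. I.2.4] [cite: ArakiMoriya2003, Theorem 12.11] -/
theorem IsVarEquilibrium.varPressure_add_le (h : ω.IsVarEquilibrium β Ψ R) (β₁ : ℝ) (Ψ₁ : FermionInteraction d) (R₁ : ℝ) :
    Ψ.varPressure β R + β * ω.meanEnergy Ψ R - β₁ * ω.meanEnergy Ψ₁ R₁ ≤ Ψ₁.varPressure β₁ R₁ := by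
  have h1 := Ψ₁.sub_mul_le_varPressure β₁ R₁ h.1
  rw [← h.2]
  linarith

/-- **Energy is antitone in `β` across equilibria of the same interaction**: `(β₁ − β)(e_Ψ(ω₁) − e_Ψ(ω)) ≤ 0`.
[cite: Israel1979, Thm. I.2.4] -/
theorem IsVarEquilibrium.mul_sub_meanEnergy_sub_nonpos (h : ω.IsVarEquilibrium β Ψ R) {β₁ : ℝ} {ω₁ : InfVolFermionState d}
    (h₁ : ω₁.IsVarEquilibrium β₁ Ψ R) :
    (β₁ - β) * (ω₁.meanEnergy Ψ R - ω.meanEnergy Ψ R) ≤ 0 := by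
  have a := h.varPressure_add_le β₁ Ψ R
  have b := h₁.varPressure_add_le β Ψ R
  nlinarith [a, b]

variable {ι : Type*} [Fintype ι] {Ψ₀ : FermionInteraction d} {Ψv : ι → FermionInteraction d}

/-- **The cross-variational inequality at `T > 0`**: for equilibria `ω` at couplings `θ` and `ω'` at `θ'` (same `β`),
`β Σ_a (θ'_a − θ_a)(e_a(ω') − e_a(ω)) ≤ 0` — each conjugate density is antitone in its own coupling (at `β > 0`).
[cite: Israel1979, Thm. I.2.4] -/
theorem IsVarEquilibrium.sum_mul_sub_mul_sub_nonpos {θ θ' : ι → ℝ}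
    (h : ω.IsVarEquilibrium β (FermionInteraction.linearFamily Ψ₀ Ψv θ) R)
    (h' : ω'.IsVarEquilibrium β (FermionInteraction.linearFamily Ψ₀ Ψv θ') R) :
    β * ∑ a, (θ' a - θ a) * (ω'.meanEnergy (Ψv a) R - ω.meanEnergy (Ψv a) R) ≤ 0 := by
  have a := h.varPressure_add_le β (FermionInteraction.linearFamily Ψ₀ Ψv θ') R
  have b := h'.varPressure_add_le β (FermionInteraction.linearFamily Ψ₀ Ψv θ) R
  rw [ω.meanEnergy_linearFamily_eq_add_sum_sub_mul Ψ₀ Ψv θ' θ R] at a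
  rw [ω'.meanEnergy_linearFamily_eq_add_sum_sub_mul Ψ₀ Ψv θ θ' R] at b
  have e : β * ∑ a, (θ' a - θ a) * (ω'.meanEnergy (Ψv a) R - ω.meanEnergy (Ψv a) R) =
      -(β * ∑ a, (θ a - θ' a) * ω'.meanEnergy (Ψv a) R) - β * ∑ a, (θ' a - θ a) * ω.meanEnergy (Ψv a) R := by
    rw [Finset.mul_sum, Finset.mul_sum, Finset.mul_sum, ← Finset.sum_neg_distrib, ← Finset.sum_sub_distrib]
    exact Finset.sum_congr rfl fun i _ => by ring
  rw [e]
  linarith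

/-- **Griffiths/Bogoliubov bracket, right side**: for an equilibrium `ω` at `θ` and the coupling `a` moved by `+δ`:
`β·δ·(−e_a(ω)) ≤ P(θ + δ·1_a) − P(θ)`, i.e. `P(θ + δ1_a) ≥ P(θ) − βδ e_a(ω)` — a pressure floor at a neighbouring coupling from the
conjugate density, and (for `βδ > 0`) the CAP `−e_a(ω) ≤ (P(θ+δ1_a) − P(θ))/(βδ)`. [cite: Israel1979, Thm. I.2.4] -/
theorem IsVarEquilibrium.varPressure_sub_mul_le_update [DecidableEq ι] {θ : ι → ℝ}
    (h : ω.IsVarEquilibrium β (FermionInteraction.linearFamily Ψ₀ Ψv θ) R) (a : ι) (δ : ℝ) :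
    (FermionInteraction.linearFamily Ψ₀ Ψv θ).varPressure β R - β * δ * ω.meanEnergy (Ψv a) R ≤
      (FermionInteraction.linearFamily Ψ₀ Ψv (θ + Pi.single a δ)).varPressure β R := by
  set θ' : ι → ℝ := θ + Pi.single a δ with hθ'
  have hm := h.varPressure_add_le β (FermionInteraction.linearFamily Ψ₀ Ψv θ') R
  rw [ω.meanEnergy_linearFamily_eq_add_sum_sub_mul Ψ₀ Ψv θ' θ R] at hm
  have hs : ∑ x, (θ' x - θ x) * ω.meanEnergy (Ψv x) R = δ * ω.meanEnergy (Ψv a) R := by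
    simp only [hθ', Pi.add_apply, add_sub_cancel_left]
    rw [Finset.sum_eq_single a]
    · rw [Pi.single_eq_same]
    · intro b _ hb; rw [Pi.single_eq_of_ne hb, zero_mul]
    · intro ha; exact absurd (Finset.mem_univ a) ha
  rw [hs] at hm
  linarith

end InfVolFermionState

/-! ### §4 The `t–t'` Hubbard model: the variational pressure IS the grand-canonical pressure; thermal states are equilibria -/

section Hubbard

/-- **The grand-canonical `t–t'` Hubbard interaction** `Φ(t,t',U) − μ·n − h·(n↑ − n↓)` as a linear family over the two on-site
directions (particle number, spin imbalance). [cite: ArakiMoriya2003, §4.1] -/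
def gcInteractionTT' (t t' U μ hz : ℝ) : FermionInteraction 2 :=
  FermionInteraction.linearFamily (hubbardTTPrimeFermionInteraction t t' U)
    ![numberInteraction 2, spinImbalanceInteraction 2] ![-μ, -hz]

/-- Its mean energy is `u(ω) = e_Φ(ω) − μρ(ω) − h m(ω)`. [cite: ArakiMoriya2003, §4.1] -/
theorem InfVolFermionState.meanEnergy_gcInteractionTT' (ω : InfVolFermionState 2) (t t' U μ hz R : ℝ) :
    ω.meanEnergy (gcInteractionTT' t t' U μ hz) R =
      ω.meanEnergy (hubbardTTPrimeFermionInteraction t t' U) R - μ * ω.density -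
        hz * ((ω.expect ({0} : Finset (Site 2)) (nAt 0 (mem_singleton_self 0) 0)).re -
          (ω.expect ({0} : Finset (Site 2)) (nAt 0 (mem_singleton_self 0) 1)).re) := by
  rw [gcInteractionTT', ω.meanEnergy_linearFamily, Fin.sum_univ_two]
  simp only [Matrix.cons_val_zero, Matrix.cons_val_one]
  rw [ω.meanEnergy_numberInteraction, ω.meanEnergy_spinImbalanceInteraction]
  ring

variable {β : ℝ} (hβ : 0 ≤ β) (t t' : ℝ) {U : ℝ} (hU : 0 ≤ U) (μ hz : ℝ)
include hβ hU

/-- **Upper half**: `s̄(ω) − β u(ω) ≤ P(β; t,t',U; μ,h)` for every translation-invariant `ω` (the Gibbs variational bound of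
`…ThermalStatesEntropyDensity` in `limsup` form). [cite: ArakiMoriya2003, Theorem 3.8 and §10] -/
theorem InfVolFermionState.IsTranslationInvariant.entropyDensitySup_sub_mul_le_gcPressureTT'Zeeman {ω : InfVolFermionState 2}
    (hω : ω.IsTranslationInvariant) :
    ω.entropyDensitySup - β * ω.meanEnergy (gcInteractionTT' t t' U μ hz) 1 ≤ gcPressureTT'Zeeman β t t' U μ hz := by
  rw [sub_le_iff_le_add, ω.meanEnergy_gcInteractionTT']
  refine ω.entropyDensitySup_le_of_eventually fun ε hε => ?_
  filter_upwards [hω.eventually_vonNeumannEntropy_rdm_div_sq_le hβ t t' hU μ hz hε] with ℓ hℓ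
  linarith

/-- **THE VARIATIONAL PRESSURE OF THE `t–t'` HUBBARD MODEL IS THE GRAND-CANONICAL PRESSURE**:
`P(β, Φ(t,t',U) − μn − hm) = gcPressureTT'Zeeman β t t' U μ h` (`β ≥ 0`, `U ≥ 0`; upper half for every TI state, attained by the thermal
grand-canonical torus-limit states). [cite: ArakiMoriya2003, Theorem 3.8 and §10] [cite: Israel1979, Thm. I.2.4] -/
theorem varPressure_gcInteractionTT'_eq :
    (gcInteractionTT' t t' U μ hz).varPressure β 1 = gcPressureTT'Zeeman β t t' U μ hz := by
  refine le_antisymm ((gcInteractionTT' t t' U μ hz).varPressure_le β 1 fun ω hω =>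
    hω.entropyDensitySup_sub_mul_le_gcPressureTT'Zeeman hβ t t' hU μ hz) ?_
  obtain ⟨Ls, ω, hLs, hω, hTI⟩ := InfVolFermionState.exists_isTorusLimitOfMixture_gcGibbs_translationInvariant β t t' U μ hz
  have hlim := hω.tendsto_vonNeumannEntropy_rdm_div_sq_of_gcGibbs hβ t t' hU μ hz hLs
  have hs := ω.entropyDensitySup_eq_of_tendsto hlim
  have h := (gcInteractionTT' t t' U μ hz).sub_mul_le_varPressure β 1 hTI
  rw [hs, ω.meanEnergy_gcInteractionTT'] at h
  linarith

/-- **Thermal grand-canonical torus-limit states are variational equilibrium states.** [cite: ArakiMoriya2003, Theorem 12.11] -/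
theorem InfVolFermionState.IsTorusLimitOfMixture.isVarEquilibrium_of_gcGibbs {ω : InfVolFermionState 2} {Ls : ℕ → ℕ}
    (hω : ω.IsTorusLimitOfMixture sourcedGibbsCount (gcGibbsWeightTT' β t t' U μ hz) (gcGibbsVectorTT' t t' U μ hz) Ls)
    (hLs : Tendsto Ls atTop atTop) :
    ω.IsVarEquilibrium β (gcInteractionTT' t t' U μ hz) 1 := by
  refine ⟨hω.isTranslationInvariant, ?_⟩
  have hlim := hω.tendsto_vonNeumannEntropy_rdm_div_sq_of_gcGibbs hβ t t' hU μ hz hLs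
  rw [ω.entropyDensitySup_eq_of_tendsto hlim, varPressure_gcInteractionTT'_eq hβ t t' hU μ hz, ω.meanEnergy_gcInteractionTT']
  ring

omit hβ in
/-- **CANONICAL thermal torus-limit states are variational equilibrium states** of the grand-canonical interaction at `(μ₀, 0)` for every
supporting chemical potential `μ₀` of `p(β;·)` at `n`. [cite: ArakiMoriya2003, Theorem 12.11] [cite: Israel1979, Thm. I.2.4] -/
theorem InfVolFermionState.IsTorusLimitOfMixture.isVarEquilibrium_of_sectorGibbs {β : ℝ} (hβ : 0 < β) {ω : InfVolFermionState 2}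
    {Ls : ℕ → ℕ} {n : ℝ} (hn0 : 0 < n) (hn2 : n < 2)
    (h : ω.IsTorusLimitOfMixture (sectorGibbsCount n) (fun L => sectorGibbsWeightTT' β t t' U n L)
      (fun L => sectorGibbsVectorTT' t t' U n L) Ls)
    (hLs : Tendsto Ls atTop atTop) {μ₀ : ℝ} (hμ₀ : pressureTT' β t t' U n = gcPressureTT' β t t' U μ₀ - β * μ₀ * n) :
    ω.IsVarEquilibrium β (gcInteractionTT' t t' U μ₀ 0) 1 := by
  refine ⟨h.isTranslationInvariant, ?_⟩
  have hlim := h.tendsto_vonNeumannEntropy_rdm_div_sq_gc_of_sectorGibbs t t' hU hβ hn0 hn2 hLs hμ₀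
  rw [ω.entropyDensitySup_eq_of_tendsto hlim, varPressure_gcInteractionTT'_eq hβ.le t t' hU μ₀ 0, ω.meanEnergy_gcInteractionTT']
  ring

omit hβ μ hz in
/-- **Canonical constrained bound**: `s̄(ω) − β e_Φ(ω) ≤ p(β; t,t',U; ρ(ω))` for every translation-invariant `ω` with `0 < ρ(ω) < 2`,
`β > 0`. [cite: Israel1979, Lemma II.3.1] -/
theorem InfVolFermionState.IsTranslationInvariant.entropyDensitySup_sub_mul_le_pressureTT' {β : ℝ} (hβ : 0 < β)
    {ω : InfVolFermionState 2} (hω : ω.IsTranslationInvariant) (hρ0 : 0 < ω.density) (hρ2 : ω.density < 2) :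
    ω.entropyDensitySup - β * ω.meanEnergy (hubbardTTPrimeFermionInteraction t t' U) 1 ≤ pressureTT' β t t' U ω.density := by
  rw [sub_le_iff_le_add]
  refine ω.entropyDensitySup_le_of_eventually fun ε hε => ?_
  set c : ℝ := β * (8 * |t| + 16 * |t'|) + 4 with hc
  have hc0 : 0 ≤ c := by rw [hc]; positivity
  have hlim : Tendsto (fun ℓ : ℕ => c / (ℓ : ℝ)) atTop (𝓝 0) := tendsto_const_div_atTop_nhds_zero_nat c
  filter_upwards [(tendsto_order.1 hlim).2 ε hε, eventually_ge_atTop 1] with ℓ hℓ hℓ1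
  have h := hω.vonNeumannEntropy_rdm_halfOpenBox_div_sq_le_pressureTT' t t' hU hβ hρ0 hρ2 hℓ1
  rw [← hc] at h
  linarith

omit hβ μ hz in
/-- **…attained by canonical thermal states**: `s̄(ω) − β e_Φ(ω) = p(β;n)`, `ρ(ω) = n`. [cite: ArakiMoriya2003, Theorem 3.8 and §10] -/
theorem InfVolFermionState.IsTorusLimitOfMixture.entropyDensitySup_sub_mul_eq_pressureTT'_of_sectorGibbs {β : ℝ} (hβ : 0 < β)
    {ω : InfVolFermionState 2} {Ls : ℕ → ℕ} {n : ℝ} (hn0 : 0 < n) (hn2 : n < 2)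
    (h : ω.IsTorusLimitOfMixture (sectorGibbsCount n) (fun L => sectorGibbsWeightTT' β t t' U n L)
      (fun L => sectorGibbsVectorTT' t t' U n L) Ls)
    (hLs : Tendsto Ls atTop atTop) :
    ω.entropyDensitySup - β * ω.meanEnergy (hubbardTTPrimeFermionInteraction t t' U) 1 = pressureTT' β t t' U n := by
  have hlim := h.tendsto_vonNeumannEntropy_rdm_div_sq_of_sectorGibbs t t' hU hβ hn0 hn2 hLs
  rw [ω.entropyDensitySup_eq_of_tendsto hlim]
  ring

end Hubbard

end Literature.MathematicalPhysics.QuantumLattice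

end
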